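import Summits.CriticalPhenomena.CardyFormulaZ2.Theorems.CardyMeckeFlipFlipErgodicityZ2StubJointKernelLimitSandwich

/-!
# Crux `FlipErgodicityZ2` (stmt-CriticalPhenomena-14825), line `registered`, stub
# `stub_jointKernelLimit`: node N1e — joint convergence at all real cutoffs

Route `Summits/CriticalPhenomena/CardyFormulaZ2/Theses/CardyMeckeFlip`.  Helper file (supports the
crux item).  Node N1e of the registered stub `stub_jointKernelLimit` (Garban–Pete–Schramm 2013
Thm. 4.3/§4.7 for bond-`ℤ²`): given kernels `M ε` on a countable cutoff set `A` with the joint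
graph convergence of the configuration and the `A × 𝓓`-indexed lattice functionals (node N1abc),
an everywhere-antitone version `M₀` agreeing with `M` on `A` almost surely, and the SMALL-GAP
ORACLE — every cutoff `ε₀ ∉ A` is bracketed by cutoffs `q' < ε₀ < q` of `A` whose bounded gap
functional `∫ min 1 (max 0 (C (∫ χ d(M q' S) - ∫ χ d(M q S)))) dμ` is as small as desired — the
joint convergence `E F(ω_δ, (⟨μ^{εⱼ}_δ, φⱼ⟩)ⱼ) → ∫ F(S, (∫ φⱼ d(M₀ εⱼ S))ⱼ) dμ` holds for ALL
finite families of positive real cutoffs and test functions in `C_c(ℂ)`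
(`tendsto_jointLaw_realCutoffs`, the registered helper headline in closed form is
`nodeN1e_realCutoffs`).

Proof.  Two-sided approximation (`tendsto_pair_of_approx`): the `j`-th coordinate at cutoff
`εⱼ` is approximated by the same test function at the bracketing cutoff `qⱼ ∈ A`; on the lattice
`|⟨μ^{εⱼ}_δ, φⱼ⟩ - ⟨μ^{qⱼ}_δ, φⱼ⟩| ≤ Cⱼ (⟨μ^{q'ⱼ}_δ, χⱼ⟩ - ⟨μ^{qⱼ}_δ, χⱼ⟩)` almost surely for
`δ ≤ q'ⱼ` (`μ^q_δ ≤ μ^{ε}_δ ≤ μ^{q'}_δ` as measures, `|φⱼ| ≤ Cⱼ χⱼ`), in the limit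
`|∫ φⱼ d(M₀ εⱼ S) - ∫ φⱼ d(M qⱼ S)| ≤ Cⱼ (∫ χⱼ d(M q'ⱼ S) - ∫ χⱼ d(M qⱼ S))` almost surely
(`M qⱼ S = M₀ qⱼ S ≤ M₀ εⱼ S ≤ M₀ q'ⱼ S = M q'ⱼ S`); the bounded errors are controlled by the
gap functionals, whose lattice expectations converge to their limit means by the joint graph
convergence itself, and these are small by the oracle.
-/

noncomputable section

open MeasureTheory Set Filter Metric Function
open Literature.Probability.Percolation Literature.Probability.Percolation.QuadCrossing
open Literature.Probability.LatticeModels Literature.Probability.Distributions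
open scoped ENNReal Topology BoundedContinuousFunction CompactlySupported

namespace Summit.CriticalPhenomena.CardyFormulaZ2.Theorems.CardyMeckeFlip

/-- The bounded gap functional `(S, x) ↦ min 1 (max 0 (C (x i - x i')))` is a bounded continuous
function on `ℋ × ℝ^ι`. [folklore] -/
theorem exists_bcf_gap {E ι : Type*} [TopologicalSpace E] (C : ℝ) (i i' : ι) :
    ∃ G : (E × (ι → ℝ)) →ᵇ ℝ, ∀ S x, G (S, x) = min 1 (max 0 (C * (x i - x i'))) := by
  have hc : Continuous fun p : E × (ι → ℝ) => min 1 (max 0 (C * (p.2 i - p.2 i'))) := by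
    fun_prop
  refine ⟨BoundedContinuousFunction.ofNormedAddCommGroup _ hc 1 fun p => ?_, fun S x => rfl⟩
  rw [Real.norm_eq_abs, abs_of_nonneg (le_min zero_le_one (le_max_left _ _))]
  exact min_le_left _ _

/-- **Pointwise sandwich for a finite family.**  If `ma j ≤ mt j ≤ mu j` are measures on `ℂ`
finite on compact sets and `|φⱼ| ≤ Cⱼ χⱼ` (`χⱼ ≥ 0`, `Cⱼ ≥ 0`, all in `C_c`), then the bounded
distance between the vectors `(∫ φⱼ d(mt j))ⱼ` and `(∫ φⱼ d(ma j))ⱼ` is at most the sum of the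
bounded gap functionals `min 1 (max 0 (Cⱼ (∫ χⱼ d(mu j) - ∫ χⱼ d(ma j))))`. [folklore] -/
theorem min_one_dist_le_sum_gap {m : ℕ} {φ χ : Fin m → ℂ → ℝ} {C : Fin m → ℝ}
    (hφ : ∀ j, Continuous (φ j)) (hφc : ∀ j, HasCompactSupport (φ j))
    (hχ : ∀ j, Continuous (χ j)) (hχc : ∀ j, HasCompactSupport (χ j)) (hχ0 : ∀ j x, 0 ≤ χ j x)
    (hC0 : ∀ j, 0 ≤ C j) (hdom : ∀ j x, |φ j x| ≤ C j * χ j x) {mt ma mu : Fin m → Measure ℂ}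
    (hmt : ∀ j, IsFiniteMeasureOnCompacts (mt j)) (hma : ∀ j, IsFiniteMeasureOnCompacts (ma j))
    (hmu : ∀ j, IsFiniteMeasureOnCompacts (mu j)) (h₂ : ∀ j, ma j ≤ mt j) (h₁ : ∀ j, mt j ≤ mu j) :
    min 1 (dist (fun j => ∫ x, φ j x ∂(mt j)) (fun j => ∫ x, φ j x ∂(ma j))) ≤
      ∑ j, min 1 (max 0 (C j * (∫ x, χ j x ∂(mu j) - ∫ x, χ j x ∂(ma j)))) := by
  have ht : ∀ j, 0 ≤ C j * (∫ x, χ j x ∂(mu j) - ∫ x, χ j x ∂(ma j)) := fun j => by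
    haveI := hmu j
    refine mul_nonneg (hC0 j) (sub_nonneg.2 (integral_mono_measure ((h₂ j).trans (h₁ j))
      (ae_of_all _ (hχ0 j)) ((hχ j).integrable_of_hasCompactSupport (hχc j))))
  have hj : ∀ j, |∫ x, φ j x ∂(mt j) - ∫ x, φ j x ∂(ma j)| ≤
      C j * (∫ x, χ j x ∂(mu j) - ∫ x, χ j x ∂(ma j)) := fun j => by
    haveI := hmt j; haveI := hma j; haveI := hmu j
    exact abs_integral_sub_le_of_le_of_le (h₂ j) (h₁ j) (hφ j) (hφc j) (hχ j) (hχc j) (hχ0 j)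
      (hC0 j) (hdom j)
  have hdist : dist (fun j => ∫ x, φ j x ∂(mt j)) (fun j => ∫ x, φ j x ∂(ma j)) ≤
      ∑ j, C j * (∫ x, χ j x ∂(mu j) - ∫ x, χ j x ∂(ma j)) :=
    (dist_pi_le_iff (Finset.sum_nonneg fun j _ => ht j)).2 fun j => by
      rw [Real.dist_eq]
      exact (hj j).trans (Finset.single_le_sum (fun i _ => ht i) (Finset.mem_univ j))
  calc min 1 (dist (fun j => ∫ x, φ j x ∂(mt j)) (fun j => ∫ x, φ j x ∂(ma j)))
      ≤ min 1 (∑ j, C j * (∫ x, χ j x ∂(mu j) - ∫ x, χ j x ∂(ma j))) := min_le_min le_rfl hdist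
    _ ≤ ∑ j, min 1 (C j * (∫ x, χ j x ∂(mu j) - ∫ x, χ j x ∂(ma j))) :=
        min_one_sum_le _ _ fun j _ => ht j
    _ = ∑ j, min 1 (max 0 (C j * (∫ x, χ j x ∂(mu j) - ∫ x, χ j x ∂(ma j)))) :=
        Finset.sum_congr rfl fun j _ => by rw [max_eq_right (ht j)]

/-- **Node N1e: joint convergence at all real cutoffs from the small-gap oracle.**  Data: the
uniform second moments (B2); a probability law `μ` on `ℋ`; a mesh sequence `δ_k → 0⁺`; a
dominated-dense test family `𝓓`; positive cutoffs `A`; measurable kernels `M ε` finite on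
compacts, locally `μ`-integrable on `A`, with the joint graph convergence on `A × 𝓓` along
`δ_k`; a measurable everywhere-antitone family `M₀` with `M₀ d S = M d S` for all `d ∈ A`, a.s.;
and the oracle: for `ε₀ > 0` off `A`, `χ ∈ 𝓓` with values in `[0, 1]`, `C ≥ 0` and `η > 0` there
are `q' < ε₀ < q` in `A` with `∫ min 1 (max 0 (C (∫ χ d(M q' S) - ∫ χ d(M q S)))) dμ < η`.
Conclusion: for all finite families `εⱼ > 0`, `φⱼ ∈ C_c(ℂ)` and bounded continuous `F`,
`E F(ω_{δ_k}, (⟨μ^{εⱼ}_{δ_k}, φⱼ⟩)ⱼ) → ∫ F(S, (∫ φⱼ d(M₀ εⱼ S))ⱼ) dμ(S)`. [folklore] -/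
theorem tendsto_jointLaw_realCutoffs
    (hmom : ∀ ε : ℝ, 0 < ε → ∀ φ : ℂ → ℝ, Continuous φ → HasCompactSupport φ →
      ∃ C δ₀ : ℝ, 0 < δ₀ ∧ ∀ δ : ℝ, 0 < δ → δ ≤ δ₀ →
        ∫ ω, (∫ x, |φ x| ∂(z2PivotalMeasure ε δ ω)) ^ 2 ∂(bondPercolation (zdGraph 2) half) ≤ C)
    (μ : Measure (QuadConfig (univ : Set ℂ))) [IsProbabilityMeasure μ] {δs : ℕ → ℝ}
    (hpos : ∀ k, 0 < δs k) (h0 : Tendsto δs atTop (𝓝 0)) {𝓓 : Set C_c(ℂ, ℝ)}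
    (hdense : ∀ K : Set ℂ, IsCompact K → ∃ χ ∈ 𝓓, (∀ x, χ x ∈ Icc (0 : ℝ) 1) ∧ (∀ x ∈ K, χ x = 1) ∧
      ∀ f : C_c(ℂ, ℝ), support f ⊆ K → ∀ η : ℝ, 0 < η → ∃ g ∈ 𝓓, ∀ x, |f x - g x| ≤ η * χ x)
    {A : Set ℝ} (hApos : ∀ ε ∈ A, 0 < ε) {M : ℝ → QuadConfig (univ : Set ℂ) → Measure ℂ}
    (hMm : ∀ ε, Measurable (M ε)) (hMfin : ∀ ε S, IsFiniteMeasureOnCompacts (M ε S))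
    (hMint : ∀ ε ∈ A, ∀ r : ℝ, ∫⁻ S, M ε S (closedBall 0 r) ∂μ < ⊤)
    (hG : ∀ G : (QuadConfig (univ : Set ℂ) × (A × 𝓓 → ℝ)) →ᵇ ℝ,
      Tendsto (fun k => ∫ ω, G (z2QuadConfig (univ : Set ℂ) (δs k) ω,
          fun p => ∫ x, (p.2 : C_c(ℂ, ℝ)) x ∂(z2PivotalMeasure (p.1 : ℝ) (δs k) ω))
        ∂(bondPercolation (zdGraph 2) half)) atTop
        (𝓝 (∫ S, G (S, fun p => ∫ x, (p.2 : C_c(ℂ, ℝ)) x ∂(M (p.1 : ℝ) S)) ∂μ)))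
    {M₀ : ℝ → QuadConfig (univ : Set ℂ) → Measure ℂ} (hM₀m : ∀ ε, Measurable (M₀ ε))
    (hM₀anti : ∀ ε ε' : ℝ, ε' ≤ ε → ∀ S, M₀ ε S ≤ M₀ ε' S)
    (hM₀ae : ∀ᵐ S ∂μ, ∀ d ∈ A, M₀ d S = M d S)
    (horacle : ∀ ε₀ : ℝ, 0 < ε₀ → ε₀ ∉ A → ∀ χ ∈ 𝓓, (∀ x, χ x ∈ Icc (0 : ℝ) 1) →
      ∀ C : ℝ, 0 ≤ C → ∀ η : ℝ, 0 < η → ∃ q ∈ A, ∃ q' ∈ A, q' < ε₀ ∧ ε₀ < q ∧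
        ∫ S, min 1 (max 0 (C * (∫ x, χ x ∂(M q' S) - ∫ x, χ x ∂(M q S)))) ∂μ < η)
    {m : ℕ} {εs : Fin m → ℝ} (hεs : ∀ j, 0 < εs j) {φ : Fin m → ℂ → ℝ}
    (hφ : ∀ j, Continuous (φ j)) (hφc : ∀ j, HasCompactSupport (φ j))
    (F : (QuadConfig (univ : Set ℂ) × (Fin m → ℝ)) →ᵇ ℝ) :
    Tendsto (fun k => ∫ ω, F (z2QuadConfig (univ : Set ℂ) (δs k) ω,
        fun j => ∫ x, φ j x ∂(z2PivotalMeasure (εs j) (δs k) ω)) ∂(bondPercolation (zdGraph 2) half))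
      atTop (𝓝 (∫ S, F (S, fun j => ∫ x, φ j x ∂(M₀ (εs j) S)) ∂μ)) := by
  classical
  -- `ℋ` is metrisable (Schramm–Smirnov Thm. 1.4); `P_½` is a probability measure
  haveI : T2Space (QuadConfig (univ : Set ℂ)) :=
    (SchrammSmirnov2011_thm_1_4_holds univ isOpen_univ univ_nonempty).1.2.2
  haveI : TopologicalSpace.MetrizableSpace (QuadConfig (univ : Set ℂ)) :=
    (SchrammSmirnov2011_thm_1_4_holds univ isOpen_univ univ_nonempty).1.2.1
  haveI : IsProbabilityMeasure (bondPercolation (zdGraph 2) half) := by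
    unfold bondPercolation; infer_instance
  -- sup bounds `|φⱼ| ≤ Cⱼ` and dominating cutoffs `|φⱼ| ≤ Cⱼ χⱼ`, `χⱼ ∈ 𝓓`
  have hbd : ∀ j, ∃ C : ℝ, 0 ≤ C ∧ ∀ x, |φ j x| ≤ C := fun j => by
    obtain ⟨C, hC⟩ := (hφ j).bounded_above_of_compact_support (hφc j)
    refine ⟨max C 0, le_max_right _ _, fun x => le_trans ?_ (le_max_left _ _)⟩
    rw [← Real.norm_eq_abs]
    exact hC x
  choose C hC0 hC using hbd
  have hcut : ∀ j, ∃ χ ∈ 𝓓, (∀ x, χ x ∈ Icc (0 : ℝ) 1) ∧ ∀ x, |φ j x| ≤ C j * χ x := fun j => by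
    obtain ⟨χ, hχ, h01, h1, -⟩ := hdense (tsupport (φ j)) (hφc j)
    refine ⟨χ, hχ, h01, fun x => ?_⟩
    by_cases hx : x ∈ tsupport (φ j)
    · rw [h1 x hx, mul_one]
      exact hC j x
    · rw [image_eq_zero_of_notMem_tsupport hx, abs_zero]
      exact mul_nonneg (hC0 j) (h01 x).1
  choose χ hχ hχ01 hdom using hcut
  have hχ0 : ∀ j x, 0 ≤ χ j x := fun j x => (hχ01 j x).1
  -- the bracketing cutoffs from the oracle (only used for `εs j ∉ A`)
  have hbr : ∀ j, εs j ∉ A → ∀ n : ℕ, ∃ q ∈ A, ∃ q' ∈ A, q' < εs j ∧ εs j < q ∧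
      ∫ S, min 1 (max 0 (C j * (∫ x, χ j x ∂(M q' S) - ∫ x, χ j x ∂(M q S)))) ∂μ <
        1 / (((n : ℝ) + 1) * ((m : ℝ) + 1)) := fun j hj n =>
    horacle (εs j) (hεs j) hj (χ j) (hχ j) (hχ01 j) (C j) (hC0 j) _ (by positivity)
  choose! qf hqfA qf' hqf'A hqf'lt hltqf hgap using hbr
  set r : Fin m → ℕ → ℝ := fun j n => if εs j ∈ A then εs j else qf j n with hr
  set r' : Fin m → ℕ → ℝ := fun j n => if εs j ∈ A then εs j else qf' j n with hr'
  have hrA : ∀ j n, r j n ∈ A := fun j n => by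
    by_cases h : εs j ∈ A
    · simp only [hr, h, if_true]
    · simp only [hr, h, if_false]; exact hqfA j h n
  have hr'A : ∀ j n, r' j n ∈ A := fun j n => by
    by_cases h : εs j ∈ A
    · simp only [hr', h, if_true]
    · simp only [hr', h, if_false]; exact hqf'A j h n
  have hr'le : ∀ j n, r' j n ≤ εs j := fun j n => by
    by_cases h : εs j ∈ A
    · simp only [hr', h, if_true, le_refl]
    · simp only [hr', h, if_false]; exact (hqf'lt j h n).le
  have hler : ∀ j n, εs j ≤ r j n := fun j n => by
    by_cases h : εs j ∈ A
    · simp only [hr, h, if_true, le_refl]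
    · simp only [hr, h, if_false]; exact (hltqf j h n).le
  have hr'pos : ∀ j n, 0 < r' j n := fun j n => hApos _ (hr'A j n)
  have hrpos : ∀ j n, 0 < r j n := fun j n => hApos _ (hrA j n)
  -- the bounded gap functionals and their limit means
  have hGΓex : ∀ j (n : ℕ), ∃ G : (QuadConfig (univ : Set ℂ) × (A × 𝓓 → ℝ)) →ᵇ ℝ, ∀ S x,
      G (S, x) = min 1 (max 0 (C j * (x (⟨r' j n, hr'A j n⟩, ⟨χ j, hχ j⟩) -
        x (⟨r j n, hrA j n⟩, ⟨χ j, hχ j⟩)))) := fun j n => exists_bcf_gap _ _ _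
  choose GΓ hGΓ using hGΓex
  have hΓle : ∀ j n, ∫ S, GΓ j n (S, fun p => ∫ x, (p.2 : C_c(ℂ, ℝ)) x ∂(M (p.1 : ℝ) S)) ∂μ ≤
      1 / (((n : ℝ) + 1) * ((m : ℝ) + 1)) := fun j n => by
    simp only [hGΓ]
    by_cases h : εs j ∈ A
    · have e : r' j n = r j n := by simp only [hr, hr', h, if_true]
      simp only [e, sub_self, mul_zero, max_self, min_eq_right zero_le_one, integral_zero]
      positivity
    · have e1 : r j n = qf j n := by simp only [hr, h, if_false]
      have e2 : r' j n = qf' j n := by simp only [hr', h, if_false]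
      rw [e1, e2]
      exact (hgap j h n).le
  have hsum : ∀ n : ℕ, ∑ j : Fin m, ∫ S, GΓ j n (S, fun p => ∫ x, (p.2 : C_c(ℂ, ℝ)) x ∂(M (p.1 : ℝ) S)) ∂μ
      ≤ 1 / ((n : ℝ) + 1) := fun n => by
    calc ∑ j : Fin m, ∫ S, GΓ j n (S, fun p => ∫ x, (p.2 : C_c(ℂ, ℝ)) x ∂(M (p.1 : ℝ) S)) ∂μ
        ≤ ∑ _j : Fin m, 1 / (((n : ℝ) + 1) * ((m : ℝ) + 1)) := Finset.sum_le_sum fun j _ => hΓle j n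
      _ = (m : ℝ) * (1 / (((n : ℝ) + 1) * ((m : ℝ) + 1))) := by
          rw [Finset.sum_const, Finset.card_univ, Fintype.card_fin, nsmul_eq_mul]
      _ = 1 / ((n : ℝ) + 1) * ((m : ℝ) / ((m : ℝ) + 1)) := by
          field_simp
      _ ≤ 1 / ((n : ℝ) + 1) * 1 := by
          gcongr
          exact (div_le_one (by positivity)).2 (by linarith)
      _ = 1 / ((n : ℝ) + 1) := mul_one _
  -- integrability of the gap functionals on the lattice and in the limit
  have hGΓi : ∀ j n k, Integrable (fun ω => GΓ j n (z2QuadConfig (univ : Set ℂ) (δs k) ω,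
      fun p => ∫ x, (p.2 : C_c(ℂ, ℝ)) x ∂(z2PivotalMeasure (p.1 : ℝ) (δs k) ω)))
      (bondPercolation (zdGraph 2) half) := fun j n k => by
    simp only [hGΓ]
    refine Integrable.of_bound ?_ 1 (ae_of_all _ fun ω => ?_)
    · exact (measurable_const.min (measurable_const.max
        (((measurable_integral_z2PivotalMeasure (hr'pos j n) (hpos k) (χ j).continuous
          (χ j).hasCompactSupport).sub (measurable_integral_z2PivotalMeasure (hrpos j n) (hpos k)
          (χ j).continuous (χ j).hasCompactSupport)).const_mul (C j)))).aestronglyMeasurable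
    · rw [Real.norm_eq_abs, abs_of_nonneg (le_min zero_le_one (le_max_left _ _))]
      exact min_le_left _ _
  have hGΓi' : ∀ j n, Integrable (fun S => GΓ j n (S, fun p => ∫ x, (p.2 : C_c(ℂ, ℝ)) x ∂(M (p.1 : ℝ) S)))
      μ := fun j n => by
    simp only [hGΓ]
    refine Integrable.of_bound ?_ 1 (ae_of_all _ fun S => ?_)
    · exact (measurable_const.min (measurable_const.max
        (((measurable_integral_of_measurable_measure (hMm _) (χ j).continuous.stronglyMeasurable).sub
          (measurable_integral_of_measurable_measure (hMm _)
            (χ j).continuous.stronglyMeasurable)).const_mul (C j)))).aestronglyMeasurable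
    · rw [Real.norm_eq_abs, abs_of_nonneg (le_min zero_le_one (le_max_left _ _))]
      exact min_le_left _ _
  -- the approximation lemma
  refine tendsto_pair_of_approx (P := bondPercolation (zdGraph 2) half) (μ := μ)
    (X := fun k => z2QuadConfig (univ : Set ℂ) (δs k))
    (v := fun k ω j => ∫ x, φ j x ∂(z2PivotalMeasure (εs j) (δs k) ω))
    (w := fun S j => ∫ x, φ j x ∂(M₀ (εs j) S))
    (va := fun n k ω j => ∫ x, φ j x ∂(z2PivotalMeasure (r j n) (δs k) ω))
    (wa := fun n S j => ∫ x, φ j x ∂(M (r j n) S))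
    (fun k => measurable_z2QuadConfig isOpen_univ (hpos k))
    (fun k => measurable_pi_lambda _ fun j =>
      measurable_integral_z2PivotalMeasure (hεs j) (hpos k) (hφ j) (hφc j))
    (measurable_pi_lambda _ fun j =>
      measurable_integral_of_measurable_measure (hM₀m _) (hφ j).stronglyMeasurable)
    (fun n k => measurable_pi_lambda _ fun j =>
      measurable_integral_z2PivotalMeasure (hrpos j n) (hpos k) (hφ j) (hφc j))
    (fun n => measurable_pi_lambda _ fun j =>
      measurable_integral_of_measurable_measure (hMm _) (hφ j).stronglyMeasurable)
    (fun n G => tendsto_jointLaw_z2PivotalMeasure_of_testFamily hmom μ hpos h0 hdense hApos hMm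
      hMfin hMint hG (εs := fun j => r j n) (fun j => hrA j n) hφ hφc G)
    (b := fun n => 1 / ((n : ℝ) + 1)) tendsto_one_div_add_atTop_nhds_zero_nat
    (fun n η hη => ?_) (fun n => ?_) F
  · -- lattice side: eventually `δ_k ≤ q'ⱼ`, a.s. `ω ⊆ E(ℤ²)`, then the sandwich
    have hev : ∀ᶠ k in atTop, ∀ j, δs k ≤ r' j n :=
      eventually_all.2 fun j => h0.eventually (Iic_mem_nhds (hr'pos j n))
    have hlim : Tendsto (fun k => ∑ j, ∫ ω, GΓ j n (z2QuadConfig (univ : Set ℂ) (δs k) ω,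
        fun p => ∫ x, (p.2 : C_c(ℂ, ℝ)) x ∂(z2PivotalMeasure (p.1 : ℝ) (δs k) ω))
        ∂(bondPercolation (zdGraph 2) half)) atTop
        (𝓝 (∑ j, ∫ S, GΓ j n (S, fun p => ∫ x, (p.2 : C_c(ℂ, ℝ)) x ∂(M (p.1 : ℝ) S)) ∂μ)) :=
      tendsto_finsetSum _ fun j _ => hG (GΓ j n)
    have hev2 := hlim.eventually (gt_mem_nhds (show
      ∑ j, ∫ S, GΓ j n (S, fun p => ∫ x, (p.2 : C_c(ℂ, ℝ)) x ∂(M (p.1 : ℝ) S)) ∂μ <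
        1 / ((n : ℝ) + 1) + η by linarith [hsum n]))
    filter_upwards [hev, hev2] with k hk hk2
    refine le_trans ?_ hk2.le
    rw [← integral_finsetSum _ fun j _ => hGΓi j n k]
    refine integral_mono_ae (integrable_min_one_dist
      (measurable_pi_lambda _ fun j =>
        measurable_integral_z2PivotalMeasure (hεs j) (hpos k) (hφ j) (hφc j))
      (measurable_pi_lambda _ fun j =>
        measurable_integral_z2PivotalMeasure (hrpos j n) (hpos k) (hφ j) (hφc j)))
      (integrable_finsetSum _ fun j _ => hGΓi j n k) ?_
    filter_upwards [ae_subset_edgeSet (zdGraph 2) half] with ω hω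
    simp only [hGΓ]
    exact min_one_dist_le_sum_gap hφ hφc (fun j => (χ j).continuous)
      (fun j => (χ j).hasCompactSupport) hχ0 hC0 hdom
      (mt := fun j => z2PivotalMeasure (εs j) (δs k) ω)
      (ma := fun j => z2PivotalMeasure (r j n) (δs k) ω)
      (mu := fun j => z2PivotalMeasure (r' j n) (δs k) ω)
      (fun j => isFiniteMeasureOnCompacts_z2PivotalMeasure _ (hpos k) ω)
      (fun j => isFiniteMeasureOnCompacts_z2PivotalMeasure _ (hpos k) ω)
      (fun j => isFiniteMeasureOnCompacts_z2PivotalMeasure _ (hpos k) ω)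
      (fun j => z2PivotalMeasure_mono (hpos k) ((hk j).trans (hr'le j n)) (hler j n) hω)
      (fun j => z2PivotalMeasure_mono (hpos k) (hk j) (hr'le j n) hω)
  · -- limit side: the sandwich on the a.s. set where `M₀ = M` on `A`
    refine le_trans ?_ (hsum n)
    rw [← integral_finsetSum _ fun j _ => hGΓi' j n]
    refine integral_mono_ae (integrable_min_one_dist
      (measurable_pi_lambda _ fun j =>
        measurable_integral_of_measurable_measure (hM₀m _) (hφ j).stronglyMeasurable)
      (measurable_pi_lambda _ fun j =>
        measurable_integral_of_measurable_measure (hMm _) (hφ j).stronglyMeasurable))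
      (integrable_finsetSum _ fun j _ => hGΓi' j n) ?_
    filter_upwards [hM₀ae] with S hS
    simp only [hGΓ]
    have h₂ : ∀ j, M (r j n) S ≤ M₀ (εs j) S := fun j => by
      rw [← hS (r j n) (hrA j n)]
      exact hM₀anti (r j n) (εs j) (hler j n) S
    have h₁ : ∀ j, M₀ (εs j) S ≤ M (r' j n) S := fun j => by
      rw [← hS (r' j n) (hr'A j n)]
      exact hM₀anti (εs j) (r' j n) (hr'le j n) S
    exact min_one_dist_le_sum_gap hφ hφc (fun j => (χ j).continuous)
      (fun j => (χ j).hasCompactSupport) hχ0 hC0 hdom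
      (mt := fun j => M₀ (εs j) S) (ma := fun j => M (r j n) S) (mu := fun j => M (r' j n) S)
      (fun j => by haveI := hMfin (r' j n) S; exact isFiniteMeasureOnCompacts_of_le (h₁ j))
      (fun j => hMfin _ S) (fun j => hMfin _ S) h₂ h₁


/-- **Node N1e: joint convergence at all real cutoffs from the small-gap oracle** — the
registered helper headline of this file in closed form; see `tendsto_jointLaw_realCutoffs`.
[folklore] -/
theorem nodeN1e_realCutoffs :
    (∀ ε : ℝ, 0 < ε → ∀ φ : ℂ → ℝ, Continuous φ → HasCompactSupport φ → ∃ C δ₀ : ℝ, 0 < δ₀ ∧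
      ∀ δ : ℝ, 0 < δ → δ ≤ δ₀ → ∫ ω, (∫ x,
      |φ x| ∂(z2PivotalMeasure ε δ ω)) ^ 2 ∂(bondPercolation (zdGraph 2) half) ≤ C) →
      ∀ (μ : FiniteMeasure (QuadConfig (Set.univ : Set ℂ))),
      IsProbabilityMeasure (μ : Measure (QuadConfig (Set.univ : Set ℂ))) → ∀ (δs : ℕ → ℝ), (∀ k,
      0 < δs k) → Tendsto δs atTop (𝓝 0) → ∀ (𝓓 : Set (CompactlySupportedContinuousMap ℂ ℝ)),
      (∀ K : Set ℂ, IsCompact K → ∃ χ ∈ 𝓓, (∀ x, χ x ∈ Set.Icc (0 : ℝ) 1) ∧ (∀ x ∈ K, χ x = 1) ∧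
      ∀ f : CompactlySupportedContinuousMap ℂ ℝ, Function.support f ⊆ K → ∀ η : ℝ, 0 < η →
      ∃ g ∈ 𝓓, ∀ x, |f x - g x| ≤ η * χ x) → ∀ (A : Set ℝ), (∀ ε ∈ A, 0 < ε) → ∀ (M : ℝ →
      QuadConfig (Set.univ : Set ℂ) → Measure ℂ), (∀ ε, Measurable (M ε)) → (∀ ε S,
      IsFiniteMeasureOnCompacts (M ε S)) → (∀ ε ∈ A, ∀ r : ℝ, ∫⁻ S,
      M ε S (Metric.closedBall 0 r) ∂(μ : Measure (QuadConfig (Set.univ : Set ℂ))) < ⊤) →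
      (∀ G : BoundedContinuousFunction (QuadConfig (Set.univ : Set ℂ) × (A × 𝓓 → ℝ)) ℝ,
      Tendsto (fun k => ∫ ω, G (z2QuadConfig (Set.univ : Set ℂ) (δs k) ω, fun p => ∫ x,
      (p.2 : CompactlySupportedContinuousMap ℂ ℝ) x ∂(z2PivotalMeasure (p.1 : ℝ) (δs k) ω))
      ∂(bondPercolation (zdGraph 2) half)) atTop (𝓝 (∫ S, G (S, fun p => ∫ x,
      (p.2 : CompactlySupportedContinuousMap ℂ ℝ) x ∂(M (p.1 : ℝ) S)) ∂(μ : Measure (QuadConfig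
      (Set.univ : Set ℂ)))))) → ∀ (M₀ : ℝ → QuadConfig (Set.univ : Set ℂ) → Measure ℂ), (∀ ε,
      Measurable (M₀ ε)) → (∀ ε ε' : ℝ, ε' ≤ ε → ∀ S, M₀ ε S ≤ M₀ ε' S) →
      (∀ᵐ S ∂(μ : Measure (QuadConfig (Set.univ : Set ℂ))), ∀ d ∈ A, M₀ d S = M d S) → (∀ ε₀ : ℝ,
      0 < ε₀ → ε₀ ∉ A → ∀ χ ∈ 𝓓, (∀ x, χ x ∈ Set.Icc (0 : ℝ) 1) → ∀ C : ℝ, 0 ≤ C → ∀ η : ℝ,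
      0 < η → ∃ q ∈ A, ∃ q' ∈ A, q' < ε₀ ∧ ε₀ < q ∧ ∫ S, min 1 (max 0 (C * (∫ x,
      χ x ∂(M q' S) - ∫ x, χ x ∂(M q S)))) ∂(μ : Measure (QuadConfig (Set.univ : Set ℂ))) < η) →
      ∀ (m : ℕ) (εs : Fin m → ℝ) (φ : Fin m → ℂ → ℝ), (∀ j, 0 < εs j) → (∀ j, Continuous (φ j)) →
      (∀ j, HasCompactSupport (φ j)) → ∀ F : BoundedContinuousFunction (QuadConfig (Set.univ : Set
      ℂ) × (Fin m → ℝ)) ℝ, Tendsto (fun k => ∫ ω, F (z2QuadConfig (Set.univ : Set ℂ) (δs k) ω,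
      fun j => ∫ x, φ j x ∂(z2PivotalMeasure (εs j) (δs k) ω)) ∂(bondPercolation (zdGraph 2)
      half)) atTop (𝓝 (∫ S, F (S, fun j => ∫ x,
      φ j x ∂(M₀ (εs j) S)) ∂(μ : Measure (QuadConfig (Set.univ : Set ℂ))))) := by
  intro hmom μ hμP δs hpos h0 𝓓 hdense A hApos M hMm hMfin hMint hG M₀ hM₀m hM₀anti hM₀ae horacle
    m εs φ hεs hφ hφc F
  haveI := hμP
  exact tendsto_jointLaw_realCutoffs hmom (μ : Measure (QuadConfig (univ : Set ℂ))) hpos h0 hdense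
    hApos hMm hMfin hMint hG hM₀m hM₀anti hM₀ae horacle hεs hφ hφc F

end Summit.CriticalPhenomena.CardyFormulaZ2.Theorems.CardyMeckeFlip

end
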